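import Literature.Topology.FourManifolds.RasmussenWellDefinedR
import Literature.Topology.FourManifolds.GaussDiagramsPoleAvoidance
import Literature.Topology.FourManifolds.GaussDiagramsIsotopyStability
import HarnessLib

/-!
# Towards `Knot.reidemeisterR`: the fact in projection form, its unconditional cases, and the
# reduction of its direction `→` to pole-avoiding isotopies and their non-regular times

Sibling proof file of `RasmussenWellDefinedR.lean` (D-0014), towards the named fact
`Literature.Topology.FourManifolds.Knot.reidemeisterR` (**Reidemeister's theorem, Gauss-diagram
form, for the full oriented move set**: knots with Gauss diagrams `G, G'` are isotopic iff
`G.REquiv G'`; `→` Reidemeister (1927) with Polyak (2010), Thm. 1.2, `←` Goussarov–Polyak–Viro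
(2000), Thm. 1.B). The fact is NOT discharged here (both directions are theories absent from the
tree: generic one-parameter families of projections and their elementary events for `→`, the
group system of virtual knots and Waldhausen's theorem for `←`). This file records, sorry-free:

* `Knot.reidemeisterR_iff` — the fact is the conjunction of its two directions read on regular
  projections (`HasGaussDiagram K G` is `∃ P : K.RegularProjection, P.diagram = G`);
* `Knot.reidemeisterR_of` — **staging** (`X_of (inputs)`): `reidemeisterR` follows from
  (i) the direction `→` for ambient isotopies along which the knot never meets the north pole —
  by pole avoidance (`GaussDiagramsPoleAvoidance.lean`: dilate into the southern hemisphere and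
  use the southern knots-in-a-ball theorem) this is all of `→` — and (ii) the direction `←` on
  projections (GPV (2000), Thm. 1.B);
* unconditional cases of `→`: the same knot read twice (`Knot.HasGaussDiagram.rEquiv`, reading
  uniqueness `GaussDiagramsReadUnique.lean`), and an ambient isotopy missing the pole along which
  the knot stays in regular position (`Knot.rEquiv_of_forall_nonempty_regularProjection_along`,
  stability `GaussDiagramsIsotopyStability.lean`: then only relabellings occur). What remains of
  `→` is thus exactly the passage through the (generically finitely many) non-regular times;
* the direction `→` is **local in time**
  (`Knot.RegularProjection.rEquiv_diagram_along_of_local`, a Lebesgue-number chain along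
  `[a, b]`): given density of the regular times, only the non-regular times need a local
  hypothesis (the elementary events); `Knot.reidemeisterR_of_local` is the corresponding refined
  staging of the fact;
* with **finitely many events** (`Knot.RegularProjection.rEquiv_diagram_along_of_finite`,
  via `forall_rEquiv_diagram_of_straddle`: at an isolated non-regular time one before/after pair
  of readings suffices) the remaining input of `→` is, per event, a single comparison of the Gauss
  diagrams read just before and just after it; `Knot.reidemeisterR_of_finite_events` stages the
  fact accordingly (genericity + events for `→`, GPV for `←`).

## References

* K. Reidemeister, *Elementare Begründung der Knotentheorie*, Abh. Math. Sem. Univ. Hamburg 5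
  (1927) 24–32; *Knotentheorie* (1932), Kap. I §1. [Reidemeister1927] [Reidemeister1932]
* M. Polyak, *Minimal generating sets of Reidemeister moves*, Quantum Topol. 1 (2010), Thm. 1.2.
  [Polyak2010]
* M. Goussarov, M. Polyak, O. Viro, *Finite-type invariants of classical and virtual knots*,
  Topology 39 (2000), Thm. 1.B (arXiv Thm. 1.2: "Virtually isotopic classical knots are isotopic.
  Proof. The group system extends to virtual knots … the group system is a complete knot
  invariant."). [GPV2000]
-/

open scoped Manifold
open Function Set

noncomputable section

namespace Literature.Topology.FourManifolds

namespace Knot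

/-! ### The fact in projection form -/

/-- **`reidemeisterR` is the conjunction of its two directions read on regular projections.**
[cite: Reidemeister1927] -/
theorem reidemeisterR_iff :
    reidemeisterR ↔
      (∀ {K K' : Knot} (P : K.RegularProjection) (P' : K'.RegularProjection),
          K.IsIsotopic K' → P.diagram.REquiv P'.diagram) ∧
        ∀ {K K' : Knot} (P : K.RegularProjection) (P' : K'.RegularProjection),
          P.diagram.REquiv P'.diagram → K.IsIsotopic K' := by
  constructor
  · intro h
    exact ⟨fun P P' hKK' ↦ (h ⟨P, rfl⟩ ⟨P', rfl⟩).1 hKK', fun P P' hPP' ↦ (h ⟨P, rfl⟩ ⟨P', rfl⟩).2 hPP'⟩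
  · rintro ⟨hfwd, hbwd⟩ K K' G G' ⟨P, rfl⟩ ⟨P', rfl⟩
    exact ⟨hfwd P P', hbwd P P'⟩

/-- **Staging of `reidemeisterR`**: it follows from (i) its direction `→` for ambient isotopies
along which the knot never meets the north pole (pole avoidance,
`rEquiv_diagram_of_isIsotopic_of_forall_ne_northPole`, supplies the rest of `→`) and (ii) its
direction `←` on projections (GPV (2000), Thm. 1.B). Neither input is proved in the tree.
[cite: Reidemeister1927] -/
theorem reidemeisterR_of
    (hfwd : ∀ {K K' : Knot} (P : K.RegularProjection) (P' : K'.RegularProjection)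
      (F : AmbientIsotopy (𝓡 3) (Metric.sphere (0 : EuclideanSpace ℝ (Fin 4)) 1)),
      (∀ t, ∀ x : Metric.sphere (0 : EuclideanSpace ℝ (Fin 2)) 1, F.toFun t (K x) ≠ northPole) →
      F.toFun 1 ∘ ⇑K = ⇑K' → P.diagram.REquiv P'.diagram)
    (hbwd : ∀ {K K' : Knot} (P : K.RegularProjection) (P' : K'.RegularProjection),
      P.diagram.REquiv P'.diagram → K.IsIsotopic K') :
    reidemeisterR :=
  reidemeisterR_iff.2
    ⟨fun P P' h ↦ RegularProjection.rEquiv_diagram_of_isIsotopic_of_forall_ne_northPole hfwd P P' h,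
      hbwd⟩

/-! ### Unconditional cases of the direction `→` -/

variable {K : Knot} {G G' : GaussDiagram}

/-- **Two Gauss diagrams of the same knot are `REquiv`-alent** (indeed relabellings of each other,
`HasGaussDiagram.isRelabelling`, `GaussDiagramsReadUnique.lean`): the case `K = K'` of the
direction `→` of `reidemeisterR`, unconditionally. [cite: GPV2000, §1.2] -/
theorem HasGaussDiagram.rEquiv (h : K.HasGaussDiagram G) (h' : K.HasGaussDiagram G') :
    G.REquiv G' :=
  (GaussDiagram.PolyakMove.relabel _ _ (h.isRelabelling h')).rEquiv

/-- Two Gauss diagrams of the same knot are Polyak equivalent (one move `relabel`).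
[cite: GPV2000, §1.2] -/
theorem HasGaussDiagram.equiv (h : K.HasGaussDiagram G) (h' : K.HasGaussDiagram G') :
    G.Equiv G' :=
  (GaussDiagram.PolyakMove.relabel _ _ (h.isRelabelling h')).equiv

/-- **The direction `→` along an isotopy through regular knots**: if an ambient isotopy `F` moves
`K` to `K'` (`F 1 ∘ K = K'`) without the knot ever meeting the north pole, and the moved knot
`F_t ∘ K` is in regular position at every time `t ∈ [0, 1]`, then any Gauss diagrams of `K` and
`K'` are `REquiv`-alent — indeed Polyak equivalent through relabellings only
(`RegularProjection.equiv_diagram_along_of_forall_mem_Icc`, `GaussDiagramsIsotopyStability.lean`).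
What the direction `→` of `reidemeisterR` still requires beyond this is the passage through the
non-regular times of a generic isotopy (Reidemeister's theorem proper).
[cite: Reidemeister1932, Kap. I §1] -/
theorem rEquiv_of_forall_nonempty_regularProjection_along {K K' : Knot}
    (F : AmbientIsotopy (𝓡 3) (Metric.sphere (0 : EuclideanSpace ℝ (Fin 4)) 1))
    (hF : ∀ t, ∀ x : Metric.sphere (0 : EuclideanSpace ℝ (Fin 2)) 1, F.toFun t (K x) ≠ northPole)
    (h1 : F.toFun 1 ∘ ⇑K = ⇑K')
    (hreg : ∀ t ∈ Icc (0 : ℝ) 1, Nonempty ((K.along F t).RegularProjection))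
    (h : K.HasGaussDiagram G) (h' : K'.HasGaussDiagram G') : G.REquiv G' := by
  obtain ⟨P, rfl⟩ := h
  obtain ⟨P', rfl⟩ := h'
  have e : K.along F 1 = K' := SphereEmbedding.ext h1
  obtain ⟨P₁, hP₁⟩ := RegularProjection.exists_diagram_eq_of_eq e.symm P'
  rw [← hP₁]
  exact (RegularProjection.equiv_diagram_along_of_forall_mem_Icc K F hF zero_le_one hreg P P₁).rEquiv

/-! ### The direction `→` is local in time

Reidemeister's argument proper treats a generic isotopy one non-regular instant at a time. The
following glue — a Lebesgue-number chain along `[a, b]` — reduces the direction `→` along a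
pole-avoiding ambient isotopy to two inputs at its non-regular times `t` only: regular times
accumulate at every time of `[a, b]` (for a generic isotopy the non-regular times are finitely
many), and the Gauss diagrams read shortly before and shortly after `t` are `REquiv`-alent (the
elementary events `Ω1`, `Ω2`, `Ω3` of Reidemeister (1932), Kap. I §1). Regular times need no
hypothesis: there the based, labelled diagram is locally constant
(`GaussDiagramsIsotopyStability.lean`). -/

section Local

variable {K : Knot} (F : AmbientIsotopy (𝓡 3) (Metric.sphere (0 : EuclideanSpace ℝ (Fin 4)) 1))

/-- **Chaining along `[a, b]`.** If every time of `[a, b]` has a neighbourhood any two regular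
times of which read `REquiv`-alent Gauss diagrams (on any regular projections), and the regular
times are dense in `[a, b]`, then regular projections of the moved knot at the times `a` and `b`
read `REquiv`-alent diagrams: take a Lebesgue number `δ` of the cover, equally spaced times of
mesh `< δ / 2`, and a regular time within `δ / 4` of each. [cite: Reidemeister1932, Kap. I §1] -/
theorem RegularProjection.rEquiv_diagram_along_of_forall_exists_ball {a b : ℝ} (hab : a ≤ b)
    (hdense : Icc a b ⊆ closure {t : ℝ | Nonempty ((K.along F t).RegularProjection)})
    (hU : ∀ t ∈ Icc a b, ∃ ε > 0, ∀ (s s' : ℝ) (Ps : (K.along F s).RegularProjection)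
      (Ps' : (K.along F s').RegularProjection), dist s t < ε → dist s' t < ε →
        Ps.diagram.REquiv Ps'.diagram)
    (Pa : (K.along F a).RegularProjection) (Pb : (K.along F b).RegularProjection) :
    Pa.diagram.REquiv Pb.diagram := by
  classical
  choose! ε hε hU using hU
  -- a Lebesgue number `δ` of the cover of `[a, b]` by the balls `ball t (ε t)`
  obtain ⟨δ, hδ, hδU⟩ : ∃ δ > 0, ∀ x ∈ Icc a b, ∃ t ∈ Icc a b,
      Metric.ball x δ ⊆ Metric.ball t (ε t) := by
    obtain ⟨δ, hδ, h⟩ := lebesgue_number_lemma_of_metric (ι := Icc a b)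
      (c := fun t ↦ Metric.ball (t : ℝ) (ε t)) isCompact_Icc (fun _ ↦ Metric.isOpen_ball)
      (fun x hx ↦ mem_iUnion.2 ⟨⟨x, hx⟩, Metric.mem_ball_self (hε x hx)⟩)
    exact ⟨δ, hδ, fun x hx ↦ let ⟨t, ht⟩ := h x hx; ⟨t, t.2, ht⟩⟩
  -- hence any two regular times `δ`-close to one time of `[a, b]` read `REquiv`-alent diagrams
  have key : ∀ x ∈ Icc a b, ∀ (s s' : ℝ) (Ps : (K.along F s).RegularProjection)
      (Ps' : (K.along F s').RegularProjection), dist s x < δ → dist s' x < δ →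
        Ps.diagram.REquiv Ps'.diagram := by
    intro x hx s s' Ps Ps' hs hs'
    obtain ⟨t, ht, hball⟩ := hδU x hx
    exact hU t ht s s' Ps Ps' (Metric.mem_ball.1 (hball (Metric.mem_ball.2 hs)))
      (Metric.mem_ball.1 (hball (Metric.mem_ball.2 hs')))
  -- equally spaced times `x k = a + k * h` (`k ≤ N`) of mesh `h < δ / 2`
  obtain ⟨N, hN⟩ := exists_nat_gt ((b - a) / (δ / 2))
  have hNpos : (0 : ℝ) < N := lt_of_le_of_lt (by positivity) hN
  set h : ℝ := (b - a) / N with hh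
  have hh0 : 0 ≤ h := div_nonneg (sub_nonneg.2 hab) hNpos.le
  have hNh : (N : ℝ) * h = b - a := by rw [hh]; field_simp
  have hhδ : h < δ / 2 := by
    rw [div_lt_iff₀ (by positivity)] at hN
    rw [hh, div_lt_iff₀ hNpos]
    linarith
  set x : ℕ → ℝ := fun k ↦ a + k * h with hx
  have hxmem : ∀ k : ℕ, k ≤ N → x k ∈ Icc a b := by
    intro k hk
    refine ⟨le_add_of_nonneg_right (by positivity), ?_⟩
    have : (k : ℝ) * h ≤ N * h := mul_le_mul_of_nonneg_right (Nat.cast_le.2 hk) hh0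
    simp only [hx]
    linarith
  have hxsucc : ∀ k : ℕ, dist (x (k + 1)) (x k) = h := fun k ↦ by
    rw [Real.dist_eq]
    simp only [hx]
    push_cast
    rw [show a + (↑k + 1) * h - (a + ↑k * h) = h by ring, abs_of_nonneg hh0]
  -- a regular time `s k` within `δ / 4` of each `x k`
  have hs : ∀ k : ℕ, k ≤ N → ∃ s : ℝ, Nonempty ((K.along F s).RegularProjection) ∧
      dist s (x k) < δ / 4 := fun k hk ↦ by
    obtain ⟨s, hs, hd⟩ := Metric.mem_closure_iff.1 (hdense (hxmem k hk)) (δ / 4) (by positivity)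
    exact ⟨s, hs, by rwa [dist_comm]⟩
  choose! s hsreg hsd using hs
  -- chain from `a` to `s k` by induction on `k`
  have chain : ∀ k : ℕ, k ≤ N → ∀ Pk : (K.along F (s k)).RegularProjection,
      Pa.diagram.REquiv Pk.diagram := by
    intro k
    induction k with
    | zero =>
      intro _ P0
      refine key (x 0) (hxmem 0 (Nat.zero_le _)) a (s 0) Pa P0 ?_ ((hsd 0 (Nat.zero_le _)).trans ?_)
      · simp only [hx, Nat.cast_zero, zero_mul, add_zero, dist_self]
        exact hδ
      · linarith
    | succ k ih =>
      intro hk Pk1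
      obtain ⟨Pk⟩ := hsreg k (Nat.le_of_succ_le hk)
      refine (ih (Nat.le_of_succ_le hk) Pk).trans (key (x k) (hxmem k (Nat.le_of_succ_le hk))
        (s k) (s (k + 1)) Pk Pk1 ((hsd k (Nat.le_of_succ_le hk)).trans (by linarith)) ?_)
      calc dist (s (k + 1)) (x k) ≤ dist (s (k + 1)) (x (k + 1)) + dist (x (k + 1)) (x k) :=
            dist_triangle _ _ _
        _ < δ / 4 + δ / 2 := by rw [hxsucc]; exact add_lt_add (hsd (k + 1) hk) hhδ
        _ ≤ δ := by linarith
  -- and from `s N` to `b = x N`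
  obtain ⟨PN⟩ := hsreg N le_rfl
  have hxN : x N = b := by simp only [hx]; linarith
  refine (chain N le_rfl PN).trans (key (x N) (hxmem N le_rfl) (s N) b PN Pb
    ((hsd N le_rfl).trans (by linarith)) ?_)
  rw [hxN, dist_self]
  exact hδ

/-- **The direction `→` of `reidemeisterR` is local in time.** Let the knot never meet the north
pole along the ambient isotopy `F`, and let `a ≤ b`. Suppose that the regular times are dense in
`[a, b]` and that every *non-regular* time `t ∈ [a, b]` has a neighbourhood any two regular times
of which read `REquiv`-alent Gauss diagrams. Then regular projections of the moved knot at the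
times `a` and `b` read `REquiv`-alent diagrams. (At a regular time all nearby times are regular,
`isOpen_setOf_nonempty_regularProjection_along`, and read relabelled diagrams,
`rEquiv_diagram_along_of_isPreconnected`; then chain.) For a generic isotopy the non-regular times
are finitely many and the local hypothesis is the analysis of the elementary events; this is the
shape of Reidemeister's proof. [cite: Reidemeister1932, Kap. I §1] -/
theorem RegularProjection.rEquiv_diagram_along_of_local
    (hF : ∀ t, ∀ x : Metric.sphere (0 : EuclideanSpace ℝ (Fin 2)) 1, F.toFun t (K x) ≠ northPole)
    {a b : ℝ} (hab : a ≤ b)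
    (hdense : Icc a b ⊆ closure {t : ℝ | Nonempty ((K.along F t).RegularProjection)})
    (hloc : ∀ t ∈ Icc a b, IsEmpty ((K.along F t).RegularProjection) →
      ∃ ε > 0, ∀ (s s' : ℝ) (Ps : (K.along F s).RegularProjection)
        (Ps' : (K.along F s').RegularProjection), dist s t < ε → dist s' t < ε →
          Ps.diagram.REquiv Ps'.diagram)
    (Pa : (K.along F a).RegularProjection) (Pb : (K.along F b).RegularProjection) :
    Pa.diagram.REquiv Pb.diagram := by
  refine rEquiv_diagram_along_of_forall_exists_ball F hab hdense (fun t ht ↦ ?_) Pa Pb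
  rcases isEmpty_or_nonempty ((K.along F t).RegularProjection) with h | h
  · exact hloc t ht h
  · -- a regular time: all nearby times are regular and read relabelled diagrams
    obtain ⟨ε, hε, hball⟩ :=
      Metric.isOpen_iff.1 (isOpen_setOf_nonempty_regularProjection_along K F hF) t h
    exact ⟨ε, hε, fun s s' Ps Ps' hs hs' ↦ rEquiv_diagram_along_of_isPreconnected K F hF
      (by rw [Real.ball_eq_Ioo]; exact isPreconnected_Ioo) (fun u hu ↦ hball hu)
      (Metric.mem_ball.2 hs) (Metric.mem_ball.2 hs') Ps Ps'⟩

/-- **`reidemeisterR` from the local analysis of generic isotopies** (staging, refining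
`reidemeisterR_of`): the fact follows from (i) for every pole-avoiding ambient isotopy between knots
in regular position, *some* pole-avoiding ambient isotopy between knots reading the same two Gauss
diagrams has dense regular times in `[0, 1]` and, at each non-regular time of `[0, 1]`, a
neighbourhood any two regular times of which read `REquiv`-alent diagrams (genericity and the
elementary events — Reidemeister's theorem proper, with Polyak (2010), Thm. 1.2 to express every
oriented move in `RMove`), and (ii) the direction `←` on projections (GPV (2000), Thm. 1.B).
Neither input is proved in the tree. [cite: Reidemeister1927] -/
theorem reidemeisterR_of_local
    (hgen : ∀ {K K' : Knot} (P : K.RegularProjection) (P' : K'.RegularProjection)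
      (F : AmbientIsotopy (𝓡 3) (Metric.sphere (0 : EuclideanSpace ℝ (Fin 4)) 1)),
      (∀ t, ∀ x : Metric.sphere (0 : EuclideanSpace ℝ (Fin 2)) 1, F.toFun t (K x) ≠ northPole) →
      F.toFun 1 ∘ ⇑K = ⇑K' →
      ∃ (K₁ : Knot) (F₁ : AmbientIsotopy (𝓡 3) (Metric.sphere (0 : EuclideanSpace ℝ (Fin 4)) 1))
        (P₁ : K₁.RegularProjection) (P₁' : (K₁.along F₁ 1).RegularProjection),
        P₁.diagram = P.diagram ∧ P₁'.diagram = P'.diagram ∧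
        (∀ t, ∀ x : Metric.sphere (0 : EuclideanSpace ℝ (Fin 2)) 1,
          F₁.toFun t (K₁ x) ≠ northPole) ∧
        Icc (0 : ℝ) 1 ⊆ closure {t : ℝ | Nonempty ((K₁.along F₁ t).RegularProjection)} ∧
        ∀ t ∈ Icc (0 : ℝ) 1, IsEmpty ((K₁.along F₁ t).RegularProjection) →
          ∃ ε > 0, ∀ (s s' : ℝ) (Ps : (K₁.along F₁ s).RegularProjection)
            (Ps' : (K₁.along F₁ s').RegularProjection), dist s t < ε → dist s' t < ε →
              Ps.diagram.REquiv Ps'.diagram)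
    (hbwd : ∀ {K K' : Knot} (P : K.RegularProjection) (P' : K'.RegularProjection),
      P.diagram.REquiv P'.diagram → K.IsIsotopic K') :
    reidemeisterR := by
  refine reidemeisterR_of (fun P P' F hF h1 ↦ ?_) hbwd
  obtain ⟨K₁, F₁, P₁, P₁', hP₁, hP₁', hF₁, hdense, hloc⟩ := hgen P P' F hF h1
  obtain ⟨P₀, hP₀⟩ := RegularProjection.exists_diagram_eq_of_eq (K₁.along_zero F₁).symm P₁
  rw [← hP₁, ← hP₁', ← hP₀]
  exact RegularProjection.rEquiv_diagram_along_of_local F₁ hF₁ zero_le_one hdense hloc P₀ P₁'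

/-! ### Isolated non-regular times: one straddling pair suffices; finitely many events -/

/-- **One straddling pair per isolated non-regular time suffices.** Let the knot never meet the
pole along `F`, and let every time of the punctured ball `0 < dist s t < ε` be regular. If ONE
pair of regular projections at times `s₀ ∈ (t - ε, t)` and `s₀' ∈ (t, t + ε)` reads
`REquiv`-alent diagrams, then ANY two regular projections at times of the ball `dist s t < ε` do:
on each side of `t` the diagram only gets relabelled (`rEquiv_diagram_along_of_isPreconnected`),
and if `t` itself is regular the whole ball is. This turns the local hypothesis of
`rEquiv_diagram_along_of_local` at an isolated event into a single before/after comparison.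
[cite: Reidemeister1932, Kap. I §1] -/
theorem RegularProjection.forall_rEquiv_diagram_of_straddle
    (hF : ∀ t, ∀ x : Metric.sphere (0 : EuclideanSpace ℝ (Fin 2)) 1, F.toFun t (K x) ≠ northPole)
    {t ε : ℝ} (hreg : ∀ s, dist s t < ε → s ≠ t → Nonempty ((K.along F s).RegularProjection))
    {s₀ s₀' : ℝ} (hs₀ : t - ε < s₀) (hs₀t : s₀ < t) (hts₀' : t < s₀') (hs₀' : s₀' < t + ε)
    (P₀ : (K.along F s₀).RegularProjection) (P₀' : (K.along F s₀').RegularProjection)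
    (hmove : P₀.diagram.REquiv P₀'.diagram) :
    ∀ (s s' : ℝ) (Ps : (K.along F s).RegularProjection)
      (Ps' : (K.along F s').RegularProjection), dist s t < ε → dist s' t < ε →
        Ps.diagram.REquiv Ps'.diagram := by
  have hdist : ∀ {u : ℝ}, t - ε < u → u < t + ε → dist u t < ε := fun h1 h2 ↦ by
    rw [Real.dist_eq]
    exact abs_sub_lt_iff.2 ⟨by linarith, by linarith⟩
  have hleft : ∀ u ∈ Ioo (t - ε) t, Nonempty ((K.along F u).RegularProjection) := fun u hu ↦
    hreg u (hdist hu.1 (by linarith [hu.2])) hu.2.ne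
  have hright : ∀ u ∈ Ioo t (t + ε), Nonempty ((K.along F u).RegularProjection) := fun u hu ↦
    hreg u (hdist (by linarith [hu.1]) hu.2) hu.1.ne'
  -- every regular projection at a time of the ball reads a diagram `REquiv`-alent to `P₀.diagram`
  have conn : ∀ (s : ℝ) (Ps : (K.along F s).RegularProjection), dist s t < ε →
      Ps.diagram.REquiv P₀.diagram := by
    intro s Ps hs
    have hs' := abs_sub_lt_iff.1 (Real.dist_eq s t ▸ hs)
    rcases lt_trichotomy s t with h | rfl | h
    · exact rEquiv_diagram_along_of_isPreconnected K F hF isPreconnected_Ioo hleft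
        ⟨by linarith [hs'.2], h⟩ ⟨hs₀, hs₀t⟩ Ps P₀
    · -- `t = s` is regular, hence so is the whole ball
      have hball : ∀ u ∈ Metric.ball s ε, Nonempty ((K.along F u).RegularProjection) := by
        intro u hu
        rcases eq_or_ne u s with rfl | hus
        · exact ⟨Ps⟩
        · exact hreg u (Metric.mem_ball.1 hu) hus
      exact rEquiv_diagram_along_of_isPreconnected K F hF
        (by rw [Real.ball_eq_Ioo]; exact isPreconnected_Ioo) hball (Metric.mem_ball_self
          (lt_of_le_of_lt dist_nonneg hs)) (Metric.mem_ball.2 (hdist hs₀ (by linarith))) Ps P₀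
    · exact (rEquiv_diagram_along_of_isPreconnected K F hF isPreconnected_Ioo hright
        ⟨h, by linarith [hs'.1]⟩ ⟨hts₀', hs₀'⟩ Ps P₀').trans hmove.symm
  intro s s' Ps Ps' hs hs'
  exact (conn s Ps hs).trans (conn s' Ps' hs').symm

/-- **The direction `→` along an isotopy with finitely many events.** Let the knot never meet the
pole along `F`, `a ≤ b`, and let `E ⊆ (a, b)` be a finite set of times off which, on `[a, b]`,
the moved knot is in regular position. Suppose that at each `t ∈ E`, for every `ε > 0`, some pair
of regular projections at times `s ∈ (t - ε, t)`, `s' ∈ (t, t + ε)` reads `REquiv`-alent Gauss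
diagrams (the elementary event at `t` is a Reidemeister move of Gauss diagrams, or nothing). Then
regular projections at the times `a` and `b` read `REquiv`-alent diagrams. For a generic isotopy
this is Reidemeister's theorem along it; what is not formalised is the genericity and the
analysis of the events. [cite: Reidemeister1932, Kap. I §1] -/
theorem RegularProjection.rEquiv_diagram_along_of_finite
    (hF : ∀ t, ∀ x : Metric.sphere (0 : EuclideanSpace ℝ (Fin 2)) 1, F.toFun t (K x) ≠ northPole)
    {a b : ℝ} (hab : a ≤ b) {E : Set ℝ} (hE : E.Finite) (hEab : E ⊆ Ioo a b)
    (hreg : ∀ t ∈ Icc a b, t ∉ E → Nonempty ((K.along F t).RegularProjection))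
    (hevent : ∀ t ∈ E, ∀ ε > 0, ∃ (s s' : ℝ) (Ps : (K.along F s).RegularProjection)
      (Ps' : (K.along F s').RegularProjection),
      t - ε < s ∧ s < t ∧ t < s' ∧ s' < t + ε ∧ Ps.diagram.REquiv Ps'.diagram)
    (Pa : (K.along F a).RegularProjection) (Pb : (K.along F b).RegularProjection) :
    Pa.diagram.REquiv Pb.diagram := by
  refine rEquiv_diagram_along_of_local F hF hab (fun t ht ↦ ?_) (fun t ht hemp ↦ ?_) Pa Pb
  · -- regular times are dense in `[a, b]`: an event time is approached by the times `s` above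
    by_cases htE : t ∈ E
    · refine Metric.mem_closure_iff.2 fun ε hε ↦ ?_
      obtain ⟨s, -, Ps, -, hs1, hs2, -⟩ := hevent t htE ε hε
      exact ⟨s, ⟨Ps⟩, by rw [dist_comm, Real.dist_eq]; exact abs_sub_lt_iff.2 ⟨by linarith,
        by linarith⟩⟩
    · exact subset_closure (hreg t ht htE)
  · -- a non-regular time `t` lies in `E ⊆ (a, b)`; isolate it and use one straddling pair
    have htE : t ∈ E := by
      by_contra h
      exact hemp.false (hreg t ht h).some
    have htab : t ∈ Ioo a b := hEab htE
    -- a punctured ball around `t` inside `(a, b)` and off `E`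
    obtain ⟨ε₁, hε₁, hball⟩ : ∃ ε₁ > 0, Metric.ball t ε₁ ⊆ (E \ {t})ᶜ :=
      Metric.mem_nhds_iff.1
        (((hE.subset sdiff_subset).isClosed).isOpen_compl.mem_nhds fun h ↦ h.2 rfl)
    set ε : ℝ := min ε₁ (min (t - a) (b - t)) with hεdef
    have hε : 0 < ε := lt_min hε₁ (lt_min (by linarith [htab.1]) (by linarith [htab.2]))
    have hεE : ∀ s, dist s t < ε → s ≠ t → s ∈ Icc a b ∧ s ∉ E := by
      intro s hs hst
      have hs' := abs_sub_lt_iff.1 (Real.dist_eq s t ▸ hs)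
      have h1 : ε ≤ t - a := (min_le_right _ _).trans (min_le_left _ _)
      have h2 : ε ≤ b - t := (min_le_right _ _).trans (min_le_right _ _)
      refine ⟨⟨by linarith [hs'.2], by linarith [hs'.1]⟩, fun hsE ↦ ?_⟩
      exact hball (Metric.mem_ball.2 (hs.trans_le (min_le_left _ _))) ⟨hsE, hst⟩
    obtain ⟨s₀, s₀', P₀, P₀', h1, h2, h3, h4, hmove⟩ := hevent t htE ε hε
    exact ⟨ε, hε, forall_rEquiv_diagram_of_straddle F hF
      (fun s hs hst ↦ let h := hεE s hs hst; hreg s h.1 h.2) h1 h2 h3 h4 P₀ P₀' hmove⟩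

/-- **`reidemeisterR` from generic isotopies with finitely many analysed events** (staging,
refining `reidemeisterR_of_local`): the fact follows from (i) for every pole-avoiding ambient
isotopy between knots in regular position, SOME pole-avoiding ambient isotopy between knots reading
the same two Gauss diagrams is regular on `[0, 1]` off a finite set `E ⊆ (0, 1)` of times, at
each of which arbitrarily close straddling pairs of regular projections read `REquiv`-alent
diagrams (genericity of one-parameter families of projections and the elementary events `Ω1`,
`Ω2`, `Ω3` as moves of `RMove` up to Polyak (2010), Thm. 1.2 — Reidemeister's theorem proper),
and (ii) the direction `←` on projections (GPV (2000), Thm. 1.B). Neither input is proved in the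
tree. [cite: Reidemeister1927] -/
theorem reidemeisterR_of_finite_events
    (hgen : ∀ {K K' : Knot} (P : K.RegularProjection) (P' : K'.RegularProjection)
      (F : AmbientIsotopy (𝓡 3) (Metric.sphere (0 : EuclideanSpace ℝ (Fin 4)) 1)),
      (∀ t, ∀ x : Metric.sphere (0 : EuclideanSpace ℝ (Fin 2)) 1, F.toFun t (K x) ≠ northPole) →
      F.toFun 1 ∘ ⇑K = ⇑K' →
      ∃ (K₁ : Knot) (F₁ : AmbientIsotopy (𝓡 3) (Metric.sphere (0 : EuclideanSpace ℝ (Fin 4)) 1))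
        (P₁ : K₁.RegularProjection) (P₁' : (K₁.along F₁ 1).RegularProjection) (E : Set ℝ),
        P₁.diagram = P.diagram ∧ P₁'.diagram = P'.diagram ∧
        (∀ t, ∀ x : Metric.sphere (0 : EuclideanSpace ℝ (Fin 2)) 1,
          F₁.toFun t (K₁ x) ≠ northPole) ∧
        E.Finite ∧ E ⊆ Ioo 0 1 ∧
        (∀ t ∈ Icc (0 : ℝ) 1, t ∉ E → Nonempty ((K₁.along F₁ t).RegularProjection)) ∧
        ∀ t ∈ E, ∀ ε > 0, ∃ (s s' : ℝ) (Ps : (K₁.along F₁ s).RegularProjection)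
          (Ps' : (K₁.along F₁ s').RegularProjection),
          t - ε < s ∧ s < t ∧ t < s' ∧ s' < t + ε ∧ Ps.diagram.REquiv Ps'.diagram)
    (hbwd : ∀ {K K' : Knot} (P : K.RegularProjection) (P' : K'.RegularProjection),
      P.diagram.REquiv P'.diagram → K.IsIsotopic K') :
    reidemeisterR := by
  refine reidemeisterR_of (fun P P' F hF h1 ↦ ?_) hbwd
  obtain ⟨K₁, F₁, P₁, P₁', E, hP₁, hP₁', hF₁, hE, hE01, hreg, hevent⟩ := hgen P P' F hF h1
  obtain ⟨P₀, hP₀⟩ := RegularProjection.exists_diagram_eq_of_eq (K₁.along_zero F₁).symm P₁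
  rw [← hP₁, ← hP₁', ← hP₀]
  exact RegularProjection.rEquiv_diagram_along_of_finite F₁ hF₁ zero_le_one hE hE01 hreg hevent
    P₀ P₁'

end Local

end Knot

end Literature.Topology.FourManifolds
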